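import Summits.Schanuel.Schanuel.Theorems.RootDecomp1KSiegelFunctions05

/-!
# RootDecomp1KSiegelFunctions — lens 1, generation 71, NODE 31 «THE HEIGHT BINDER HALVED: `HeightComparison ⟸ SiegelFunctionsAll`, ARITHMETIC HALF PROVED» (×0-AS-RECORD + one contingent ×1 at FLOOR G (a) — PRICE 31 L3149, RULING L3160, NODE L3172, VERDICT L3175): the node-12 hypothesis binder `HeightComparison` (Weil–Siegel height comparison on a plane curve) is, definitionally, `∀ P, GeomIrreducible P → 1 ≤ xdeg P → 1 ≤ deg_Y P → HeightComparisonAt P`, and `heightComparisonAt_of_siegelFunctions` PROVES `HeightComparisonAt P` from the GEOMETRIC datum `SiegelFunctions P ∧ SiegelFunctions (swap P)` (two integral functions of controlled degree for every b ≥ 1); the ARITHMETIC half (rational-root integrality, archimedean root bound, `h(y^b) = b·h(y)`, finite exceptional fibres by Bezout, exchange of variables) is proved sorry-free; hence `heightComparison_of_siegelFunctionsAll : SiegelFunctionsAll → HeightComparison` and the node-12 heads re-pointed BY NAME; the geometric half `SiegelFunctionsAll` is a typed HYPOTHESIS (plan S1–S6 in the docstring of `SiegelFunctions`), NOT proved;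 (G)-instances by hand: `parabP` / its transpose / `hyperbP`, and the infinite family 𝒞₃ = {(x·Y − 1)² − f(x) : f cubic, f(0) ≠ 1} in BOTH charts (Lucas trace; the 3 × 3 POWER LEMMA), its geometric irreducibility, and the HYPOTHESIS-FREE `heightComparisonAt_sqLinP` / `thinFibreAt_two_sqLinP` — ×0-AS-RECORD toolkit per RULING L3160 (every 𝒞₃ member is also decided by the numerator lever); `PadicSubspace`, items 33364 / 33363 / 31077 / 31987 and the tally UNMOVED — continuation (RootDecomp1KSiegelFunctions06): §8  THE INFINITE (G)-INSTANCE FAMILY `𝒞₃`: `sqLinP f := (x·Y − 1)² − f(x)` — CHART 1 PROVED FOR — 20 declarations `sqLinP` … `thinFibreAt_sqLinP_of_swap`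

(lens-1 g71 NODE 31 «THE HEIGHT BINDER HALVED» L3172: HOME kernel K = HOME/decomp-schanuel-lens-1/g71/lean/SiegelFunctions.lean sha256 4f39c136…, 1983 l, 207 decls (173 theorems + 34 defs by the critic's count, VERDICT L3175; NODE's «208» an e-lite), ONE namespace `Summit.Schanuel.Schanuel.Theorems.RootDecomp1KSiegelFunctions` (inner anonymous-free sections `PowerLemma` / `Chart2` / `GeomIrreducible` with their `variable`s kept whole inside one part each), imports EXACTLY the tree port …RootDecomp1KHeightGrading02 (node 12: `HeightComparison`, `HeightDecidedAt`, `GeomIrreducible`, `logHt` BY TREE NAME) + `Literature.NumberTheory.DiophantineGeometry.PlaneCurveBezoutWeak` + `Mathlib.RingTheory.Polynomial.RationalRoot`; no private / instance / set_option / notation / sorry / new axiom / native_decide / [cite; lens farm rc 0 · 0 errors · 0 sorries · dupNamespace warnings only; `#print axioms` = [propext, Classical.choice, Quot.sound] on the nine probed heads (g71/out/ax_*.json), Probe g71/out/ProbeK.lean 2659bdec… rc 0 (rfl pin `HeightComparison` = tree), CONTROLS A / A0 / B rc 1 as designed (ctrlA 4ae3a6d6… / ctrlA0 ff875685… / ctrlB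 f20add70…), memo g71/NODE-g71.md 07fb49f8…, SHA256SUMS 34 files; CLAIM 31 L3146; crit PRICE 31 L3149 (×0-as-record + one contingent ×1 at FLOOR G; CHECKLIST K-g71; RULES K-R59 / K-R60 pre-announced); lens ASK-FIRST FAMILY CLAIM L3158 (𝒞₃) and crit RULING L3160 (𝒞₃ REFUSED as a FLOOR-G (b) family: numerator lever, NUMEXP; toolkit ×0 under K-R60 (i)); census INSTRUMENT NOTES 54–56 L3161 / L3163 / L3167 (LIVENESS-v46 / v47 / v48: rows 75–77 = 𝒞₃ members, keys numexp / numexp_tight / k60) and crit ACKs L3165 / L3168; writer NOTES 4 / 5 L3162 / L3173; crit-1 (g13) VERDICT 31 L3175: «NODE 31 = ×0-AS-RECORD BOOKED; CHECKLIST K-g71 (J1)–(J7) MET; the contingent THEOREM ×1 REGISTERED under K-R59 (ii), UNPAID (FLOOR G unmet); RULES K-R59 and K-R60 (i)–(iv) FIXED; PORT GO» — kernel re-verified by the critic (farm rc 0 · 0 errors · 0 sorries; 207 decls = 173 theorems + 34 defs; axioms standard re-probed on 27 heads), record: piece C227 «HeightComparison ⟸ SiegelFunctionsAll», the K-line binder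 HeightComparison henceforth CONSUMED through heightComparison_of_siegelFunctionsAll (Dom re-pointing BY NAME, antecedent count unchanged), 𝒞₃ / InC3 decided hypothesis-free by thinFibreAt_of_inC3 / thinFibreAt_two_sqLinP = the K-R60 (i) kernel shape (TOOLKIT, ×0, never payable), tally UNCHANGED lens-1 ×22 + THEOREM ×24, EXHIBITS ρ1 / ρ2 VACANT, 33364 / 33363 / 31077 / 31987 OPEN rung 0. Port by census-1 gen 26 as `RootDecomp1KSiegelFunctions01–09` (files ≤ 400 lines; chain 01 ← the three K imports, 0k ← 0(k−1); `--supports stmt-Schanuel-33364`, the item stays OPEN; ×0 record port — the geometric binder `SiegelFunctions` / `SiegelFunctionsAll` appears ONLY as an explicit hypothesis of the `…_of_siegelFunctions…` heads, never an axiom / instance / variable; no credit anywhere; the section-aligned 9-part split is lens-1's port plan (J7) re-built by the census pipeline): 01 = K-port l.1–216 (§0 / §1) — 25 decls `ratModel`, `QDvd`, `relPoly`, …, `evalEval_ratModel_relPoly`; 02 = K-port l.219–450 (§2) — 20 decls `scaledEval`, `l1`, `l1_nonneg`, …, `abs_le_of_rel`; 03 = K-port l.453–658 (§3 / §4) — 9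 decls `HtQ_pow`, `logHt_pow`, `HtQ_intDiv_le`, …, `upperComparisonAt_of_siegelFunctions`; 04 = K-port l.661–830 (§5) — 13 decls `coeff_coeff_swap`, `map_swap`, `natDegree_swap`, …, `heightComparison_of_siegelFunctions`; 05 = K-port l.833–1109 (§6 / §7) — 28 decls `thinFibreAt_of_heightComparisonAt`, `thinFibreAt_of_heightComparison'`, `thinFibreAt_of_siegelFunctions`, …, `siegelFunctions_toys`; 06 = K-port l.1111–1304 (§8) — 20 decls `sqLinP`, `sqLinP_eq`, `natDegree_sqLinP`, …, `thinFibreAt_sqLinP_of_swap`; 07 = K-port l.1306–1551 (§9) — 35 decls `compM`, `cubic`, `cubic_eq`, …, `natDegree_det3_compM_pow_le`; 08 = K-port l.1553–1860 (§10) — 40 decls `q₃`, `q₂`, `q₁`, …, `heightComparisonAt_sqLinP_of_geomIrreducible`; 09 = K-port l.1862–2078 (§11 / §12) — 17 decls `sqLinK`, `coeff_sqLinK`, `natDegree_sqLinK`, …, `thinFibreAt_of_inC3`. 91 one-line docstrings synthesised for undocumented helper declarations (statements quoted); TWO port-side modifiers of record: `sum_Icc_half_pow` (§2, part 02) is `private`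 with a PORT NOTE after the `dedup.landed` bounce p850627 (≡ `Literature.Computability.Cryptography.HashDom.sum_Icc_half_pow`), and the consistency check `thinFibreAt_of_heightComparison'` (§6, part 05) is `private` with a PORT NOTE after the `dedup.landed` bounce p850703 (≡ node 12's `RootDecomp1KHeightGrading.thinFibreAt_of_heightComparison`, the intended identity); everything else = K VERBATIM (statements, names, proofs, K's module docstring kept in part 01 below this provenance block).)
-/

noncomputable section

namespace Summit.Schanuel.Schanuel.Theorems.RootDecomp1KSiegelFunctions

open Polynomial
open scoped Nat
open Summit.Schanuel.Schanuel.Theorems.RootDecomp1KDegreeLadder (bev xdeg natDegree_coeff_le_xdeg ThinFibreAt ThinFibre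
  thinFibreAt_of_natDegree_lt)
open Summit.Schanuel.Schanuel.Theorems.RootDecomp1KHeightGrading

/-! ### §8  THE INFINITE (G)-INSTANCE FAMILY `𝒞₃`: `sqLinP f := (x·Y − 1)² − f(x)` — CHART 1 PROVED FOR
EVERY `f` with `deg f ≥ 2` (`φ = x^b`, `ψ = (xY)^b`, the TRACE of `(xY)^b` is the Lucas sequence `V_b(2, 1 − f)`,
its NORM is `(1 − f)^b`); chart 2 (the transposes, a DOMINANT cubic chart) is the typed statement `SqLinSwapSiegel`,
PROVED in §10 via the power lemma of §9.  For `deg f = 3` the members are non-dominant (`Y`-leading coefficient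
`x²`), `xdeg = 3`, `deg_Y = 2 < 2·xdeg`, not `DecidedAt 2`, not `LocalAt 2` (the slope at `j = 2` is exactly
critical), of genus `1` for `f` squarefree — but (RULING L3160) decided anyway by the elementary numerator lever, so
the family is an INSTANCE of (G), not live territory. -/

/-- the family `(x·Y − 1)² − f(x) = hyperbP² − f`. -/
def sqLinP (f : ℤ[X]) : ℤ[X][X] := hyperbP ^ 2 - C f

/-- `(f : ℤ[X]) : sqLinP f = C (X ^ 2) * X ^ 2 - C (2 * X) * X + C (1 - f)`. -/
theorem sqLinP_eq (f : ℤ[X]) : sqLinP f = C (X ^ 2) * X ^ 2 - C (2 * X) * X + C (1 - f) := by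
  simp only [sqLinP, hyperbP, map_sub, map_mul, map_pow, map_one, map_ofNat]
  ring

/-- `(f : ℤ[X]) : (sqLinP f).natDegree = 2`. -/
theorem natDegree_sqLinP (f : ℤ[X]) : (sqLinP f).natDegree = 2 := by
  have h2 : (hyperbP ^ 2).natDegree = 2 := by rw [natDegree_pow, natDegree_hyperbP]
  rw [sqLinP, natDegree_sub_eq_left_of_natDegree_lt] <;> rw [h2]
  rw [natDegree_C]; norm_num

/-- `(f : ℤ[X]) : (1 - f).natDegree ≤ f.natDegree`. -/
theorem natDegree_one_sub_le (f : ℤ[X]) : (1 - f).natDegree ≤ f.natDegree :=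
  (natDegree_sub_le _ _).trans (by simp)

/-- `{f : ℤ[X]} (hf : 1 ≤ f.natDegree) : (1 - f).natDegree = f.natDegree`. -/
theorem natDegree_one_sub {f : ℤ[X]} (hf : 1 ≤ f.natDegree) : (1 - f).natDegree = f.natDegree := by
  rw [natDegree_sub_eq_right_of_natDegree_lt]; rw [natDegree_one]; omega

/-- `(f : ℤ[X]) : (sqLinP f).coeff 0 = 1 - f`. -/
theorem coeff_sqLinP_zero (f : ℤ[X]) : (sqLinP f).coeff 0 = 1 - f := by
  rw [sqLinP_eq, coeff_add, coeff_sub, coeff_C_mul, coeff_C_mul_X, coeff_X_pow, coeff_C_zero]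
  simp

/-- `{f : ℤ[X]} (hf : 2 ≤ f.natDegree) : xdeg (sqLinP f) = f.natDegree`. -/
theorem xdeg_sqLinP {f : ℤ[X]} (hf : 2 ≤ f.natDegree) : xdeg (sqLinP f) = f.natDegree := by
  apply le_antisymm
  · refine xdeg_le_of_coeff fun j => ?_
    rw [sqLinP_eq, coeff_add, coeff_sub]
    refine (natDegree_add_le _ _).trans (max_le ((natDegree_sub_le _ _).trans (max_le ?_ ?_)) ?_)
    · rw [coeff_C_mul, coeff_X_pow]
      split_ifs
      · rw [mul_one, natDegree_X_pow]; exact hf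
      · simp
    · rw [coeff_C_mul_X]
      split_ifs
      · have h2 : (2 : ℤ[X]).natDegree = 0 := by simp
        exact (natDegree_mul_le (p := (2 : ℤ[X])) (q := X)).trans (by rw [natDegree_X, h2]; omega)
      · simp
    · rw [coeff_C]
      split_ifs
      · exact natDegree_one_sub_le f
      · simp
  · have h := natDegree_coeff_le_xdeg (sqLinP f) 0
    rwa [coeff_sqLinP_zero, natDegree_one_sub (by omega)] at h

/-- the transposed presentation (chart 2): `swap ((xY − 1)² − f(x)) = (xY − 1)² − f(Y)` — a DOMINANT chart
(`Y`-leading coefficient `−f₃`, constant). -/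
theorem swap_sqLinP (f : ℤ[X]) : Bivariate.swap (sqLinP f) = hyperbP ^ 2 - Polynomial.map C f := by
  rw [sqLinP, map_sub, map_pow, Bivariate.swap_C, hyperbP, map_sub, map_one, map_mul, Bivariate.swap_X,
    Bivariate.swap_Y, mul_comm]

/-- the Lucas sequence `V_n(2, 1 − f)`: `V₀ = V₁ = 2`, `V_{n+2} = 2·V_{n+1} − (1 − f)·V_n` — the trace of `(xY)^n`
over `ℚ(x)` on the curve `(xY − 1)² = f(x)`. -/
def lucasV (f : ℤ[X]) : ℕ → ℤ[X]
  | 0 => 2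
  | 1 => 2
  | n + 2 => 2 * lucasV f (n + 1) - (1 - f) * lucasV f n

/-- `(f : ℤ[X]) : lucasV f 0 = 2`. -/
@[simp] theorem lucasV_zero (f : ℤ[X]) : lucasV f 0 = 2 := rfl
/-- `(f : ℤ[X]) : lucasV f 1 = 2`. -/
@[simp] theorem lucasV_one (f : ℤ[X]) : lucasV f 1 = 2 := rfl
/-- `(f : ℤ[X]) (n : ℕ) : lucasV f (n + 2) = 2 * lucasV f (n + 1) - (1 - f) * lucasV f n`. -/
theorem lucasV_add_two (f : ℤ[X]) (n : ℕ) : lucasV f (n + 2) = 2 * lucasV f (n + 1) - (1 - f) * lucasV f n := rfl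

/-- `deg V_n ≤ deg f · ⌊n/2⌋`. -/
theorem natDegree_lucasV_le (f : ℤ[X]) :
    ∀ n, (lucasV f n).natDegree ≤ f.natDegree * (n / 2) ∧ (lucasV f (n + 1)).natDegree ≤ f.natDegree * ((n + 1) / 2)
  | 0 => by simp
  | n + 1 => by
      obtain ⟨h0, h1⟩ := natDegree_lucasV_le f n
      refine ⟨h1, ?_⟩
      rw [show n + 1 + 1 = n + 2 from rfl, lucasV_add_two, Nat.add_div_right n two_pos]
      refine (natDegree_sub_le _ _).trans (max_le ?_ ?_)
      · refine natDegree_mul_le.trans ?_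
        have : (n + 1) / 2 ≤ n / 2 + 1 := by omega
        have h2 : (2 : ℤ[X]).natDegree = 0 := by simp
        rw [h2, zero_add]
        exact h1.trans (Nat.mul_le_mul_left _ this)
      · refine natDegree_mul_le.trans ?_
        have := natDegree_one_sub_le f
        rw [mul_add, mul_one]; omega

/-- the trace congruence: `(xY)^n + (2 − xY)^n ≡ V_n mod ((xY − 1)² − f)` (two-step induction on
`θ^{n+2} + θ'^{n+2} = (θ + θ')(θ^{n+1} + θ'^{n+1}) − θθ'(θ^n + θ'^n)`, `θ + θ' = 2`, `θθ' ≡ 1 − f`). -/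
theorem sqLinP_dvd_trace (f : ℤ[X]) : ∀ n,
    (sqLinP f ∣ (C X * X) ^ n + (2 - C X * X) ^ n - C (lucasV f n)) ∧
      (sqLinP f ∣ (C X * X) ^ (n + 1) + (2 - C X * X) ^ (n + 1) - C (lucasV f (n + 1)))
  | 0 => by
      refine ⟨?_, ?_⟩
      · rw [lucasV_zero, map_ofNat]; exact ⟨0, by ring⟩
      · rw [lucasV_one, map_ofNat]; exact ⟨0, by ring⟩
  | n + 1 => by
      obtain ⟨h0, h1⟩ := sqLinP_dvd_trace f n
      refine ⟨h1, ?_⟩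
      have e : (C X * X) ^ (n + 1 + 1) + (2 - C X * X) ^ (n + 1 + 1) - C (lucasV f (n + 1 + 1)) =
          2 * ((C X * X) ^ (n + 1) + (2 - C X * X) ^ (n + 1) - C (lucasV f (n + 1))) -
            (C X * X) * (2 - C X * X) * ((C X * X) ^ n + (2 - C X * X) ^ n - C (lucasV f n)) +
            sqLinP f * C (lucasV f n) := by
        rw [show n + 1 + 1 = n + 2 from rfl, lucasV_add_two]
        simp only [sqLinP, hyperbP, map_sub, map_mul, map_one, map_ofNat]
        ring
      rw [e]
      exact ((h1.mul_left 2).sub (h0.mul_left _)).add (dvd_mul_right _ _)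

/-- the norm-and-trace relation of `(xY)^b`: `(xY)^{2b} − V_b·(xY)^b + (1 − f)^b ≡ 0 mod ((xY − 1)² − f)`. -/
theorem sqLinP_dvd_rel (f : ℤ[X]) (b : ℕ) :
    sqLinP f ∣ (C X * X) ^ b * (C X * X) ^ b - C (lucasV f b) * (C X * X) ^ b + C ((1 - f) ^ b) := by
  have hA := (sqLinP_dvd_trace f b).1
  have hB : sqLinP f ∣ (C (1 - f) : ℤ[X][X]) ^ b - (C X * X) ^ b * (2 - C X * X) ^ b := by
    have e : sqLinP f = C (1 - f) - C X * X * (2 - C X * X) := by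
      simp only [sqLinP, hyperbP, map_sub, map_one]; ring
    rw [← mul_pow, e]; exact sub_dvd_pow_sub_pow _ _ b
  have e : (C X * X) ^ b * (C X * X) ^ b - C (lucasV f b) * (C X * X) ^ b + C ((1 - f) ^ b) =
      (C X * X) ^ b * ((C X * X) ^ b + (2 - C X * X) ^ b - C (lucasV f b)) +
        ((C (1 - f) : ℤ[X][X]) ^ b - (C X * X) ^ b * (2 - C X * X) ^ b) := by
    rw [map_pow]; ring
  rw [e]
  exact (hA.mul_left _).add hB

/-- `ψ = x^b·Y^b = (xY)^b` is integral of degree `≤ ⌈deg f · b/2⌉` over `ℤ[x]` mod `sqLinP f`: the relation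
`T² − V_b·T + (1 − f)^b` (`deg V_b ≤ deg f·⌊b/2⌋`, `deg (1 − f)^b ≤ deg f · b`). -/
theorem integralOfDegree_pow_sqLinP (f : ℤ[X]) (b : ℕ) :
    IntegralOfDegree (sqLinP f) ((f.natDegree * b + 1) / 2) (C (X ^ b) * X ^ b) 1 := by
  refine ⟨2, 1, fun i => if i = 1 then -lucasV f b else if i = 2 then (1 - f) ^ b else 0, one_ne_zero,
    fun i => ?_, ?_⟩
  · dsimp only
    split_ifs with h1 h2
    · subst h1
      rw [natDegree_neg, mul_one]
      refine (natDegree_lucasV_le f b).1.trans ?_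
      exact (Nat.mul_div_le_mul_div_assoc _ _ _).trans (Nat.div_le_div_right (by omega))
    · subst h2
      refine natDegree_pow_le.trans ?_
      have h := Nat.mul_le_mul_left b (natDegree_one_sub_le f)
      rw [mul_comm b f.natDegree] at h
      omega
    · simp
  · have hrel : relPoly 2 1 (fun i => if i = 1 then -lucasV f b else if i = 2 then (1 - f) ^ b else 0)
        (C (X ^ b) * X ^ b) 1 =
        (C X * X) ^ b * (C X * X) ^ b - C (lucasV f b) * (C X * X) ^ b + C ((1 - f) ^ b) := by
      rw [relPoly_two]
      simp [mul_pow]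
      ring
    unfold QDvd
    rw [hrel, ratModel_apply, ratModel_apply]
    exact map_dvd (mapRingHom (Int.castRingHom ℚ)) (sqLinP_dvd_rel f b)

/-- **CHART 1 OF `𝒞₃` — PROVED FOR EVERY `f` WITH `deg f ≥ 2`**: `SiegelFunctions ((x·Y − 1)² − f(x))`
(`c = 1`; for `b ≥ 1`: `a = ⌈deg f · b/2⌉`, `φ = x^b`, `ψ = (xY)^b`). -/
theorem siegelFunctions_sqLinP (f : ℤ[X]) (hf : 2 ≤ f.natDegree) : SiegelFunctions (sqLinP f) := by
  have hn : (sqLinP f).natDegree = 2 := natDegree_sqLinP f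
  have hk : xdeg (sqLinP f) = f.natDegree := xdeg_sqLinP hf
  refine ⟨1, fun b hb => ⟨(f.natDegree * b + 1) / 2, C (X ^ b), 1, ?_,
    not_qdvd_C (by rw [hn]; norm_num) (pow_ne_zero _ X_ne_zero), not_qdvd_one (by rw [hn]; norm_num),
    integralOfDegree_C _ ?_, integralOfDegree_pow_sqLinP f b⟩⟩
  · rw [hn, hk, mul_comm b f.natDegree]
    set N := f.natDegree * b
    omega
  · rw [natDegree_X_pow]
    have : 2 * b ≤ f.natDegree * b := Nat.mul_le_mul_right b hf
    omega

/-- [statement def — PROVED below, `sqLinSwapSiegel` §10] **CHART 2 OF `𝒞₃`**: Siegel functions on the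
transposes `(xY − 1)² − f(Y)` for cubic `f` with `f(0) ≠ 1` — a DOMINANT cubic chart (`v = x_old` is integral over
`ℚ[u]`, `u = y_old`); the Siegel functions are `φ_b = N^j`, `ψ = N^j·v^b` with `N·v = (1 − f₀) − Q` the pole-free
avatar of `(1 − f₀)/v`, `j = ⌈2b/3⌉`-ish, budget `3a ≤ 2b + 2`, the relations coming from the POWER LEMMA §9. -/
def SqLinSwapSiegel : Prop :=
  ∀ f : ℤ[X], f.natDegree = 3 → f.coeff 0 ≠ 1 → SiegelFunctions (Bivariate.swap (sqLinP f))

/-- **`ThinFibreAt 2` ON `𝒞₃` MODULO CHART 2 ONLY** (chart 1 = `siegelFunctions_sqLinP` is a theorem): for cubic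
`f` with `sqLinP f` geometrically irreducible (`f` of odd degree is never a square; `f(0) ≠ 1` for primitivity). -/
theorem thinFibreAt_two_sqLinP_of (h2 : SqLinSwapSiegel) {f : ℤ[X]} (hf : f.natDegree = 3) (h0 : f.coeff 0 ≠ 1)
    (hgi : GeomIrreducible (sqLinP f)) : ThinFibreAt 2 (sqLinP f) :=
  thinFibreAt_of_siegelFunctions hgi (by rw [xdeg_sqLinP (by omega)]; omega) (siegelFunctions_sqLinP f (by omega))
    (h2 f hf h0) (by rw [natDegree_sqLinP, xdeg_sqLinP (by omega), hf]; norm_num)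

/-- … and at every `m₀ ≥ 2`, for every `deg f ≥ 2`, modulo the Siegel functions of the transpose alone. -/
theorem thinFibreAt_sqLinP_of_swap {f : ℤ[X]} (hf : 2 ≤ f.natDegree) (hgi : GeomIrreducible (sqLinP f))
    (h2 : SiegelFunctions (Bivariate.swap (sqLinP f))) {m₀ : ℕ} (hm : 2 ≤ m₀) : ThinFibreAt m₀ (sqLinP f) :=
  thinFibreAt_of_siegelFunctions hgi (by rw [xdeg_sqLinP hf]; omega) (siegelFunctions_sqLinP f hf) h2
    (by rw [natDegree_sqLinP, xdeg_sqLinP hf]; nlinarith)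

end Summit.Schanuel.Schanuel.Theorems.RootDecomp1KSiegelFunctions
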